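import Mathlib
import Summits.AtomisticToContinuum.Crystallization.Theorems.GappedShellCensusCleanLimitsHaveWindowsBoxPinningA

/-!
# Laminar clean box, part 1: planar algebra of a near-triangular lattice `ℤu + ℤv`

Support for the registered stub `laminar_clean_box` (laminar split, line `Sketch`) of the crux
`GappedShellCensus.CleanLimitsHaveWindows` (stmt-AtomisticToContinuum-15932).

Throughout, `u v : EuclideanSpace ℝ (Fin 3)` are two *planar* vectors (third coordinate `0`) with
`‖u‖, ‖v‖, ‖u - v‖ ∈ [a(1 - 1/50), a(1 + 1/50)]` (`a > 0`): the generators of the in-plane lattice of a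
laminar set. This file collects the elementary planar facts used by the box estimates:

* planar norms / inner products in coordinates, and the Pythagorean split off the vertical direction
  `layerNormal 1` (`lcb_pyth`);
* the in-plane form `‖s u + t v‖² = s²‖u‖² + t²‖v‖² + st(‖u‖² + ‖v‖² - ‖u - v‖²)` and its lower bound
  `‖s u + t v‖² ≥ (23/25) a² (s² + st + t²)` (`lcb_comb_lower`);
* consequences on the lattice: the six vectors `±u, ±v, ±(u - v)` (indices in `bpHex`) have norm in the
  band, every other non-zero lattice vector has squared norm `≥ 69 a²/25` (`lcb_lat_far`), so a lattice
  vector of squared norm `< 69a²/25` is `0` or one of the six (`lcb_lat_near`);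
* the covering bound: every planar `x` is within squared distance `9a²/25` of the lattice (`lcb_cover`),
  through the explicit planar decomposition `x = s u + t v` (`lcb_planar_decomp`, Gram determinant
  `≥ 3a⁴/5`) and the barycentric three-corner estimate on a half cell (`lcb_tri_cover`).
-/

noncomputable section

namespace Summit.AtomisticToContinuum.Crystallization.Theorems.CleanHull

open Literature.MathematicalPhysics.StatisticalMechanics

/-! ## Planar vectors in coordinates -/

/-- The squared norm of a planar vector. [folklore] -/
theorem lcb_normSq_planar {X : EuclideanSpace ℝ (Fin 3)} (hX : X 2 = 0) :
    ‖X‖ ^ 2 = X 0 ^ 2 + X 1 ^ 2 := by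
  rw [EuclideanSpace.norm_sq_eq, Fin.sum_univ_three]
  simp [hX]

/-- The inner product with a planar vector. [folklore] -/
theorem lcb_inner_planar {X Y : EuclideanSpace ℝ (Fin 3)} (hX : X 2 = 0) :
    inner ℝ X Y = X 0 * Y 0 + X 1 * Y 1 := by
  rw [EuclideanSpace.inner_eq_star_dotProduct]
  simp [dotProduct, Fin.sum_univ_three, hX]
  ring

/-- Pythagoras off the vertical direction: `‖X + H e₃‖² = ‖X‖² + H²` for planar `X`. [folklore] -/
theorem lcb_pyth {X : EuclideanSpace ℝ (Fin 3)} (hX : X 2 = 0) (H : ℝ) :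
    ‖X + H • layerNormal 1‖ ^ 2 = ‖X‖ ^ 2 + H ^ 2 := by
  rw [EuclideanSpace.norm_sq_eq, EuclideanSpace.norm_sq_eq, Fin.sum_univ_three, Fin.sum_univ_three]
  simp [layerNormal, hX]

/-- The vertical coordinate of `X + H e₃` is `H` for planar `X`. [folklore] -/
theorem lcb_apply_two {X : EuclideanSpace ℝ (Fin 3)} (hX : X 2 = 0) (H : ℝ) :
    (X + H • layerNormal 1) 2 = H := by
  simp [layerNormal, hX]

/-! ## The in-plane form -/

/-- `‖s u + t v‖²` through the three side lengths `‖u‖, ‖v‖, ‖u - v‖`. [folklore] -/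
theorem lcb_normSq_comb (u v : EuclideanSpace ℝ (Fin 3)) (s t : ℝ) :
    ‖s • u + t • v‖ ^ 2 =
      s ^ 2 * ‖u‖ ^ 2 + t ^ 2 * ‖v‖ ^ 2 + s * t * (‖u‖ ^ 2 + ‖v‖ ^ 2 - ‖u - v‖ ^ 2) := by
  rw [norm_add_sq_real, norm_sub_sq_real, norm_smul, norm_smul, inner_smul_left, inner_smul_right,
    Real.norm_eq_abs, Real.norm_eq_abs, mul_pow, mul_pow, sq_abs, sq_abs]
  simp only [conj_trivial]
  ring

/-- Squaring the band `a(1 - 1/50) ≤ r ≤ a(1 + 1/50)`. [folklore] -/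
theorem lcb_sq_bounds {a r : ℝ} (ha : 0 < a) (h : a * (1 - 1 / 50) ≤ r ∧ r ≤ a * (1 + 1 / 50)) :
    (a * (1 - 1 / 50)) ^ 2 ≤ r ^ 2 ∧ r ^ 2 ≤ (a * (1 + 1 / 50)) ^ 2 := by
  have h0 : 0 ≤ a * (1 - 1 / 50) := by positivity
  exact ⟨pow_le_pow_left₀ h0 h.1 2, pow_le_pow_left₀ (h0.trans h.1) h.2 2⟩

/-- A coefficient `P = M ± D` times a product `s r` is `≥ M s r - D (s² + r²)/2`
(`P s r - M s r + D (s² + r²)/2 = ((P - M + D)(s + r)² + (M + D - P)(s - r)²)/4 ≥ 0`). [folklore] -/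
theorem lcb_arith_coef {P M D : ℝ} (h1 : M - D ≤ P) (h2 : P ≤ M + D) (s r : ℝ) :
    M * (s * r) - D * ((s ^ 2 + r ^ 2) / 2) ≤ P * (s * r) := by
  nlinarith [mul_nonneg (sub_nonneg.2 h1) (sq_nonneg (s + r)), mul_nonneg (sub_nonneg.2 h2) (sq_nonneg (s - r))]

/-- **Lower bound of the in-plane form**: `‖s u + t v‖² ≥ (23/25) a² (s² + st + t²)` for generators in the
band (write `‖su + tv‖² = ‖u‖² s(s+t) + ‖v‖² t(s+t) - ‖u-v‖² st`, each coefficient `= 1.0004a² ± 0.04a²`, `lcb_arith_coef`).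
[folklore] -/
theorem lcb_comb_lower {a : ℝ} {u v : EuclideanSpace ℝ (Fin 3)} (ha : 0 < a)
    (hu : a * (1 - 1 / 50) ≤ ‖u‖ ∧ ‖u‖ ≤ a * (1 + 1 / 50))
    (hv : a * (1 - 1 / 50) ≤ ‖v‖ ∧ ‖v‖ ≤ a * (1 + 1 / 50))
    (huv : a * (1 - 1 / 50) ≤ ‖u - v‖ ∧ ‖u - v‖ ≤ a * (1 + 1 / 50)) (s t : ℝ) :
    23 / 25 * a ^ 2 * (s ^ 2 + s * t + t ^ 2) ≤ ‖s • u + t • v‖ ^ 2 := by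
  rw [lcb_normSq_comb]
  obtain ⟨hu1, hu2⟩ := lcb_sq_bounds ha hu
  obtain ⟨hv1, hv2⟩ := lcb_sq_bounds ha hv
  obtain ⟨huv1, huv2⟩ := lcb_sq_bounds ha huv
  have hM1 : ∀ {P : ℝ}, (a * (1 - 1 / 50)) ^ 2 ≤ P → 2501 / 2500 * a ^ 2 - 1 / 25 * a ^ 2 ≤ P := by
    intro P hP; nlinarith
  have hM2 : ∀ {P : ℝ}, P ≤ (a * (1 + 1 / 50)) ^ 2 → P ≤ 2501 / 2500 * a ^ 2 + 1 / 25 * a ^ 2 := by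
    intro P hP; nlinarith
  have e1 := lcb_arith_coef (hM1 hu1) (hM2 hu2) s (s + t)
  have e2 := lcb_arith_coef (hM1 hv1) (hM2 hv2) t (s + t)
  have e3 := lcb_arith_coef (hM1 huv1) (hM2 huv2) s (-t)
  have hN : 0 ≤ s ^ 2 + s * t + t ^ 2 := by nlinarith [sq_nonneg (s + t), sq_nonneg s, sq_nonneg t]
  nlinarith

/-! ## The lattice `ℤu + ℤv`: the six short vectors and the rest -/

/-- `#bpHex = 6`. [folklore] -/
theorem card_bpHex : bpHex.card = 6 := by decide

/-- The integer hexagonal norm `i² + ij + j²` is `0` (origin), `1` (the six indices of `bpHex`) or `≥ 3`.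
[folklore] -/
theorem lcb_hexN_cases (i j : ℤ) :
    (i = 0 ∧ j = 0) ∨ (i, j) ∈ bpHex ∨ 3 ≤ i ^ 2 + i * j + j ^ 2 := by
  by_cases h3 : 3 ≤ i ^ 2 + i * j + j ^ 2
  · exact Or.inr (Or.inr h3)
  have h3' := not_le.1 h3
  have hj : |j| ≤ 1 := by
    rw [abs_le]; constructor <;> nlinarith [sq_nonneg (2 * i + j), sq_nonneg j]
  have hi : |i| ≤ 1 := by
    rw [abs_le]; constructor <;> nlinarith [sq_nonneg (2 * j + i), sq_nonneg i]
  obtain ⟨hj1, hj2⟩ := abs_le.1 hj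
  obtain ⟨hi1, hi2⟩ := abs_le.1 hi
  simp only [bpHex, Finset.mem_insert, Finset.mem_singleton, Prod.mk.injEq]
  interval_cases i <;> interval_cases j <;> simp_all

/-- **Far lattice vectors.** A lattice vector `i u + j v` other than `0` and the six short ones has squared
norm `≥ 69 a²/25` (`= 0.92 · 3 · a²`). [folklore] -/
theorem lcb_lat_far {a : ℝ} {u v : EuclideanSpace ℝ (Fin 3)} (ha : 0 < a)
    (hu : a * (1 - 1 / 50) ≤ ‖u‖ ∧ ‖u‖ ≤ a * (1 + 1 / 50))
    (hv : a * (1 - 1 / 50) ≤ ‖v‖ ∧ ‖v‖ ≤ a * (1 + 1 / 50))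
    (huv : a * (1 - 1 / 50) ≤ ‖u - v‖ ∧ ‖u - v‖ ≤ a * (1 + 1 / 50)) {i j : ℤ}
    (h0 : (i, j) ≠ (0, 0)) (hhex : (i, j) ∉ bpHex) :
    69 / 25 * a ^ 2 ≤ ‖(i : ℝ) • u + (j : ℝ) • v‖ ^ 2 := by
  have h := lcb_comb_lower ha hu hv huv (i : ℝ) (j : ℝ)
  rcases lcb_hexN_cases i j with ⟨rfl, rfl⟩ | h1 | h3
  · exact absurd rfl h0
  · exact absurd h1 hhex
  · have h3' : (3 : ℝ) ≤ (i : ℝ) ^ 2 + (i : ℝ) * j + (j : ℝ) ^ 2 := by exact_mod_cast h3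
    nlinarith [sq_nonneg a]

/-- **Non-zero lattice vectors** have squared norm `≥ 23 a²/25`; in particular they are non-zero vectors.
[folklore] -/
theorem lcb_lat_ne_zero {a : ℝ} {u v : EuclideanSpace ℝ (Fin 3)} (ha : 0 < a)
    (hu : a * (1 - 1 / 50) ≤ ‖u‖ ∧ ‖u‖ ≤ a * (1 + 1 / 50))
    (hv : a * (1 - 1 / 50) ≤ ‖v‖ ∧ ‖v‖ ≤ a * (1 + 1 / 50))
    (huv : a * (1 - 1 / 50) ≤ ‖u - v‖ ∧ ‖u - v‖ ≤ a * (1 + 1 / 50)) {i j : ℤ}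
    (h0 : (i, j) ≠ (0, 0)) : 23 / 25 * a ^ 2 ≤ ‖(i : ℝ) • u + (j : ℝ) • v‖ ^ 2 := by
  have h := lcb_comb_lower ha hu hv huv (i : ℝ) (j : ℝ)
  have h1 : (1 : ℤ) ≤ i ^ 2 + i * j + j ^ 2 := by
    by_contra hc
    have hc' : i ^ 2 + i * j + j ^ 2 ≤ 0 := by omega
    have hj : j = 0 := by
      by_contra hj'
      nlinarith [sq_nonneg (2 * i + j), sq_pos_of_ne_zero hj']
    have hi : i = 0 := by
      by_contra hi'
      nlinarith [sq_nonneg (2 * j + i), sq_pos_of_ne_zero hi']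
    exact h0 (by rw [hi, hj])
  have h1' : (1 : ℝ) ≤ (i : ℝ) ^ 2 + (i : ℝ) * j + (j : ℝ) ^ 2 := by exact_mod_cast h1
  nlinarith [sq_nonneg a]

/-- **The six short vectors** `±u, ±v, ±(u - v)` (indices in `bpHex`) have norm in the band. [folklore] -/
theorem lcb_lat_hex {a : ℝ} {u v : EuclideanSpace ℝ (Fin 3)}
    (hu : a * (1 - 1 / 50) ≤ ‖u‖ ∧ ‖u‖ ≤ a * (1 + 1 / 50))
    (hv : a * (1 - 1 / 50) ≤ ‖v‖ ∧ ‖v‖ ≤ a * (1 + 1 / 50))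
    (huv : a * (1 - 1 / 50) ≤ ‖u - v‖ ∧ ‖u - v‖ ≤ a * (1 + 1 / 50)) {i j : ℤ}
    (hhex : (i, j) ∈ bpHex) :
    a * (1 - 1 / 50) ≤ ‖(i : ℝ) • u + (j : ℝ) • v‖ ∧ ‖(i : ℝ) • u + (j : ℝ) • v‖ ≤ a * (1 + 1 / 50) := by
  simp only [bpHex, Finset.mem_insert, Finset.mem_singleton, Prod.mk.injEq] at hhex
  rcases hhex with ⟨rfl, rfl⟩ | ⟨rfl, rfl⟩ | ⟨rfl, rfl⟩ | ⟨rfl, rfl⟩ | ⟨rfl, rfl⟩ | ⟨rfl, rfl⟩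
  · simpa using hu
  · simpa [norm_neg] using hu
  · simpa using hv
  · simpa [norm_neg] using hv
  · push_cast
    rw [one_smul, neg_one_smul, ← sub_eq_add_neg]
    exact huv
  · push_cast
    rw [one_smul, neg_one_smul, neg_add_eq_sub, norm_sub_rev]
    exact huv

/-- **Near lattice vectors are short or zero**: a lattice vector of squared norm `< 69a²/25` has index `0` or
in `bpHex`. [folklore] -/
theorem lcb_lat_near {a : ℝ} {u v : EuclideanSpace ℝ (Fin 3)} (ha : 0 < a)
    (hu : a * (1 - 1 / 50) ≤ ‖u‖ ∧ ‖u‖ ≤ a * (1 + 1 / 50))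
    (hv : a * (1 - 1 / 50) ≤ ‖v‖ ∧ ‖v‖ ≤ a * (1 + 1 / 50))
    (huv : a * (1 - 1 / 50) ≤ ‖u - v‖ ∧ ‖u - v‖ ≤ a * (1 + 1 / 50)) {i j : ℤ}
    (h : ‖(i : ℝ) • u + (j : ℝ) • v‖ ^ 2 < 69 / 25 * a ^ 2) : (i, j) = (0, 0) ∨ (i, j) ∈ bpHex := by
  by_contra hc
  simp only [not_or] at hc
  have := lcb_lat_far ha hu hv huv hc.1 hc.2
  linarith

/-! ## Covering radius of the lattice -/

/-- The planar Gram determinant of the generators is `≥ 3a⁴/5`. [folklore] -/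
theorem lcb_gram_lower {a : ℝ} {u v : EuclideanSpace ℝ (Fin 3)} (ha : 0 < a)
    (hu : a * (1 - 1 / 50) ≤ ‖u‖ ∧ ‖u‖ ≤ a * (1 + 1 / 50))
    (hv : a * (1 - 1 / 50) ≤ ‖v‖ ∧ ‖v‖ ≤ a * (1 + 1 / 50))
    (huv : a * (1 - 1 / 50) ≤ ‖u - v‖ ∧ ‖u - v‖ ≤ a * (1 + 1 / 50)) :
    3 / 5 * a ^ 4 ≤ ‖u‖ ^ 2 * ‖v‖ ^ 2 - (inner ℝ u v) ^ 2 := by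
  have hi : inner ℝ u v = (‖u‖ ^ 2 + ‖v‖ ^ 2 - ‖u - v‖ ^ 2) / 2 := by
    rw [norm_sub_sq_real]; ring
  rw [hi]
  obtain ⟨hu1, hu2⟩ := lcb_sq_bounds ha hu
  obtain ⟨hv1, hv2⟩ := lcb_sq_bounds ha hv
  obtain ⟨huv1, huv2⟩ := lcb_sq_bounds ha huv
  have hL : 0 ≤ (a * (1 - 1 / 50)) ^ 2 := sq_nonneg _
  have hPQ : (a * (1 - 1 / 50)) ^ 2 * (a * (1 - 1 / 50)) ^ 2 ≤ ‖u‖ ^ 2 * ‖v‖ ^ 2 :=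
    mul_le_mul hu1 hv1 hL (hL.trans hu1)
  have hc0 : 0 ≤ (‖u‖ ^ 2 + ‖v‖ ^ 2 - ‖u - v‖ ^ 2) / 2 := by nlinarith
  have hc1 : (‖u‖ ^ 2 + ‖v‖ ^ 2 - ‖u - v‖ ^ 2) / 2 ≤ 2801 / 5000 * a ^ 2 := by nlinarith
  have hc2 : ((‖u‖ ^ 2 + ‖v‖ ^ 2 - ‖u - v‖ ^ 2) / 2) ^ 2 ≤ (2801 / 5000 * a ^ 2) ^ 2 :=
    pow_le_pow_left₀ hc0 hc1 2
  nlinarith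

/-- **Planar decomposition**: every planar vector is a real combination `s u + t v` (Cramer's rule; the
planar determinant of `u, v` squares to the Gram determinant, which is positive). [folklore] -/
theorem lcb_planar_decomp {a : ℝ} {u v : EuclideanSpace ℝ (Fin 3)} (ha : 0 < a)
    (hu : a * (1 - 1 / 50) ≤ ‖u‖ ∧ ‖u‖ ≤ a * (1 + 1 / 50))
    (hv : a * (1 - 1 / 50) ≤ ‖v‖ ∧ ‖v‖ ≤ a * (1 + 1 / 50))
    (huv : a * (1 - 1 / 50) ≤ ‖u - v‖ ∧ ‖u - v‖ ≤ a * (1 + 1 / 50))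
    (hu2 : u 2 = 0) (hv2 : v 2 = 0) {x : EuclideanSpace ℝ (Fin 3)} (hx2 : x 2 = 0) :
    ∃ s t : ℝ, x = s • u + t • v := by
  set D := u 0 * v 1 - u 1 * v 0 with hD
  have hdet : D ≠ 0 := by
    intro h
    have h1 : D ^ 2 = ‖u‖ ^ 2 * ‖v‖ ^ 2 - (inner ℝ u v) ^ 2 := by
      rw [hD, lcb_normSq_planar hu2, lcb_normSq_planar hv2, lcb_inner_planar hu2]; ring
    have h2 := lcb_gram_lower ha hu hv huv
    rw [← h1, h] at h2
    nlinarith [pow_pos ha 4]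
  refine ⟨(x 0 * v 1 - x 1 * v 0) / D, (u 0 * x 1 - u 1 * x 0) / D, ?_⟩
  ext k
  fin_cases k
  · simp only [Fin.zero_eta, Fin.isValue, PiLp.add_apply, PiLp.smul_apply, smul_eq_mul]
    field_simp
    rw [hD]; ring
  · simp only [Fin.mk_one, Fin.isValue, PiLp.add_apply, PiLp.smul_apply, smul_eq_mul]
    field_simp
    rw [hD]; ring
  · simp only [Fin.reduceFinMk, PiLp.add_apply, PiLp.smul_apply, smul_eq_mul, hu2, hv2, hx2]
    ring

/-- **Three-corner estimate on a half cell.** For `σ, τ ≥ 0`, `σ + τ ≤ 1`, the point `σ u + τ v` is within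
squared distance `9a²/25` of one of the corners `0, u, v`: with the barycentric weights `1 - σ - τ, σ, τ` the
weighted mean of the three squared distances is `‖u‖² σα + ‖v‖² τα + ‖u - v‖² στ ≤ (a(1 + 1/50))²/3 < 9a²/25`.
[folklore] -/
theorem lcb_tri_cover {a : ℝ} {u v : EuclideanSpace ℝ (Fin 3)} (ha : 0 < a)
    (hu : a * (1 - 1 / 50) ≤ ‖u‖ ∧ ‖u‖ ≤ a * (1 + 1 / 50))
    (hv : a * (1 - 1 / 50) ≤ ‖v‖ ∧ ‖v‖ ≤ a * (1 + 1 / 50))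
    (huv : a * (1 - 1 / 50) ≤ ‖u - v‖ ∧ ‖u - v‖ ≤ a * (1 + 1 / 50))
    {σ τ : ℝ} (hσ : 0 ≤ σ) (hτ : 0 ≤ τ) (hστ : σ + τ ≤ 1) :
    ‖σ • u + τ • v‖ ^ 2 ≤ 9 / 25 * a ^ 2 ∨ ‖(σ - 1) • u + τ • v‖ ^ 2 ≤ 9 / 25 * a ^ 2 ∨
      ‖σ • u + (τ - 1) • v‖ ^ 2 ≤ 9 / 25 * a ^ 2 := by
  by_contra hcon
  simp only [not_or, not_le] at hcon
  obtain ⟨h0, h1, h2⟩ := hcon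
  rw [lcb_normSq_comb] at h0 h1 h2
  obtain ⟨hu1, hu2⟩ := lcb_sq_bounds ha hu
  obtain ⟨hv1, hv2⟩ := lcb_sq_bounds ha hv
  obtain ⟨huv1, huv2⟩ := lcb_sq_bounds ha huv
  set P := ‖u‖ ^ 2
  set Q := ‖v‖ ^ 2
  set R := ‖u - v‖ ^ 2
  set α := 1 - σ - τ with hα
  have hα0 : 0 ≤ α := by linarith
  have key : α * (σ ^ 2 * P + τ ^ 2 * Q + σ * τ * (P + Q - R)) +
      σ * ((σ - 1) ^ 2 * P + τ ^ 2 * Q + (σ - 1) * τ * (P + Q - R)) +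
      τ * (σ ^ 2 * P + (τ - 1) ^ 2 * Q + σ * (τ - 1) * (P + Q - R)) =
      P * (σ * α) + Q * (τ * α) + R * (σ * τ) := by
    rw [hα]; ring
  have hw : σ * α + τ * α + σ * τ ≤ 1 / 3 := by
    nlinarith [sq_nonneg (σ - τ), sq_nonneg (σ - α), sq_nonneg (τ - α)]
  have hf : P * (σ * α) + Q * (τ * α) + R * (σ * τ) ≤ (a * (1 + 1 / 50)) ^ 2 * (1 / 3) := by
    have e1 : P * (σ * α) ≤ (a * (1 + 1 / 50)) ^ 2 * (σ * α) :=
      mul_le_mul_of_nonneg_right hu2 (mul_nonneg hσ hα0)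
    have e2 : Q * (τ * α) ≤ (a * (1 + 1 / 50)) ^ 2 * (τ * α) :=
      mul_le_mul_of_nonneg_right hv2 (mul_nonneg hτ hα0)
    have e3 : R * (σ * τ) ≤ (a * (1 + 1 / 50)) ^ 2 * (σ * τ) :=
      mul_le_mul_of_nonneg_right huv2 (mul_nonneg hσ hτ)
    nlinarith [sq_nonneg (a * (1 + 1 / 50))]
  have g0 := mul_le_mul_of_nonneg_left h0.le hα0
  have g1 := mul_le_mul_of_nonneg_left h1.le hσ
  have g2 := mul_le_mul_of_nonneg_left h2.le hτ
  have hsum : α + σ + τ = 1 := by rw [hα]; ring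
  nlinarith

/-- **Covering in coordinates**: every real combination `s u + t v` is within squared distance `9a²/25` of a
lattice vector (reduce to the half cell containing the fractional parts, reflecting through the cell centre
if `{s} + {t} > 1`). [folklore] -/
theorem lcb_cover_real {a : ℝ} {u v : EuclideanSpace ℝ (Fin 3)} (ha : 0 < a)
    (hu : a * (1 - 1 / 50) ≤ ‖u‖ ∧ ‖u‖ ≤ a * (1 + 1 / 50))
    (hv : a * (1 - 1 / 50) ≤ ‖v‖ ∧ ‖v‖ ≤ a * (1 + 1 / 50))
    (huv : a * (1 - 1 / 50) ≤ ‖u - v‖ ∧ ‖u - v‖ ≤ a * (1 + 1 / 50)) (s t : ℝ) :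
    ∃ i j : ℤ, ‖(s - i) • u + (t - j) • v‖ ^ 2 ≤ 9 / 25 * a ^ 2 := by
  have hs0 : 0 ≤ s - ⌊s⌋ := sub_nonneg.2 (Int.floor_le s)
  have hs1 : s - ⌊s⌋ < 1 := by linarith [Int.lt_floor_add_one s]
  have ht0 : 0 ≤ t - ⌊t⌋ := sub_nonneg.2 (Int.floor_le t)
  have ht1 : t - ⌊t⌋ < 1 := by linarith [Int.lt_floor_add_one t]
  rcases le_or_gt ((s - ⌊s⌋) + (t - ⌊t⌋)) 1 with hle | hgt
  · rcases lcb_tri_cover ha hu hv huv hs0 ht0 hle with h | h | h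
    · exact ⟨⌊s⌋, ⌊t⌋, h⟩
    · refine ⟨⌊s⌋ + 1, ⌊t⌋, ?_⟩
      push_cast
      rwa [show s - (⌊s⌋ + 1 : ℝ) = s - ⌊s⌋ - 1 by ring]
    · refine ⟨⌊s⌋, ⌊t⌋ + 1, ?_⟩
      push_cast
      rwa [show t - (⌊t⌋ + 1 : ℝ) = t - ⌊t⌋ - 1 by ring]
  · -- reflect through the centre of the cell
    have hσ : 0 ≤ 1 - (s - ⌊s⌋) := by linarith
    have hτ : 0 ≤ 1 - (t - ⌊t⌋) := by linarith
    have hle : (1 - (s - ⌊s⌋)) + (1 - (t - ⌊t⌋)) ≤ 1 := by linarith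
    rcases lcb_tri_cover ha hu hv huv hσ hτ hle with h | h | h
    · refine ⟨⌊s⌋ + 1, ⌊t⌋ + 1, ?_⟩
      rw [lcb_normSq_comb] at h ⊢
      push_cast
      linear_combination h
    · refine ⟨⌊s⌋, ⌊t⌋ + 1, ?_⟩
      rw [lcb_normSq_comb] at h ⊢
      push_cast
      linear_combination h
    · refine ⟨⌊s⌋ + 1, ⌊t⌋, ?_⟩
      rw [lcb_normSq_comb] at h ⊢
      push_cast
      linear_combination h

/-- **Covering bound.** Every planar vector is within squared distance `9a²/25` of the lattice `ℤu + ℤv`.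
[folklore] -/
theorem lcb_cover {a : ℝ} {u v : EuclideanSpace ℝ (Fin 3)} (ha : 0 < a)
    (hu : a * (1 - 1 / 50) ≤ ‖u‖ ∧ ‖u‖ ≤ a * (1 + 1 / 50))
    (hv : a * (1 - 1 / 50) ≤ ‖v‖ ∧ ‖v‖ ≤ a * (1 + 1 / 50))
    (huv : a * (1 - 1 / 50) ≤ ‖u - v‖ ∧ ‖u - v‖ ≤ a * (1 + 1 / 50))
    (hu2 : u 2 = 0) (hv2 : v 2 = 0) {x : EuclideanSpace ℝ (Fin 3)} (hx2 : x 2 = 0) :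
    ∃ i j : ℤ, ‖x - ((i : ℝ) • u + (j : ℝ) • v)‖ ^ 2 ≤ 9 / 25 * a ^ 2 := by
  obtain ⟨s, t, rfl⟩ := lcb_planar_decomp ha hu hv huv hu2 hv2 hx2
  obtain ⟨i, j, h⟩ := lcb_cover_real ha hu hv huv s t
  refine ⟨i, j, ?_⟩
  have e : s • u + t • v - ((i : ℝ) • u + (j : ℝ) • v) = (s - i) • u + (t - j) • v := by
    simp only [sub_smul]; abel
  rwa [e]

end Summit.AtomisticToContinuum.Crystallization.Theorems.CleanHull

end
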